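import Summits.AtomisticToContinuum.Crystallization.Theorems.ChartedZeroExcessLayeredLatticeLiouvilleYM

/-!
(SPLIT FOR THE 400-LINE CAP by the landing lane, hand-2 g33: this file = part 1 of 2; sequels `…ChartedZeroExcessLayeredLatticeLiouvilleYO` import it in a chain; same namespace, all FQNs unchanged.)
# Charted zero-excess layered-lattice Liouville — YO «LoadPath»: the existence leaf (QE) by a LOAD-PATH MARCH in a convex bond tube (lens-2 g68)

Node g68 of lens «structural dichotomy (special vs generic)» on docket `stmt-AtomisticToContinuum-26636`, beneath the EXISTENCE leaf (QE)
`CoolMoatSlavedFillingP` of parts YI/YM (the one leaf of the tube docket `MildTubeDocket` that is STRENGTHENED by the tube cut of part YM, and the one no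
earlier node decomposes).  CRITIC-LEDGER row 1237 endorsed «ConvexTube» TO TYPE with (T1) a VECTOR bond tube, (T2) compactness, (T3) strictness of the
inner tube, and flagged (F1) the tube floor is NOT the NearBorn cell, (F2) the a-priori estimate is the heavy input, (F3) the dial numbers.  This part types it
so that EVERY piece is load-bearing (the naive «minimise on the tube, then interior ⇒ critical» glue needs neither convexity nor uniqueness: rejected), imports
the tree part YM, and lands after YM.

* **YO-1 THE LOAD-PATH ENGINE (abstract, PROVED; pure Mathlib).**  `exists_hasFDerivAt_zero_of_loadPath`: `T₁ ⊆ T` compact convex with a uniform margin,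
  `E` FIRST-ORDER STRONGLY CONVEX on `T` (modulus `lam`, weight `D ≥ ‖·‖²`), A-PRIORI CONFINEMENT of every `T`-solution of the LOADED equations
  `DE(z) = (1 − t)·DE(y₀)`, `t ∈ [0, 1]`, to `T₁` ⟹ `E` has a critical point in `T₁`.  THE MARCH: `N` load increments with `‖DE(y₀)‖/(2·lam·N) ≤ gap`; the
  `T`-minimiser of the `k`-th tilted energy lies within `gap` of its predecessor (two variational inequalities `IsLocalMinOn.hasFDerivWithinAt_nonneg` on the
  convex tube + the two convexity inequalities), hence is INTERIOR (the predecessor sits in `T₁`), hence CRITICAL (Fermat, `IsLocalMin.hasFDerivAt_eq_zero`),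
  hence in `T₁` (confinement); at `k = N` the tilt vanishes.  First derivatives only — the tree has no Hessian objects and needs none here.  Bonus:
  `eq_of_hasFDerivAt_zero_of_strongConvexOn` (TUBE RIGIDITY: two critical points in `T` coincide).
* **YO-2 THE VECTOR BOND TUBE `bondTube X Rg sb dI dB y₀ ⊆ (Fin n → E3)` (NEW data def + 8 lemmas, PROVED).**  Three radii about a reference filling `y₀`:
  BOND DEVIATION `dist (z i − z j, y₀ i − y₀ j) ≤ sb` on every pair with `dist (y₀ i, y₀ j) ≤ Rg` (a VECTOR condition — (T1): it controls bond angles, hence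
  star tameness), INTERFACE PIN `dist (z i, y₀ i) ≤ dI` at sites within `Rg` of the frozen exterior `X`, BULK PIN `dist (z i, y₀ i) ≤ dB` (loose; it only
  makes the tube COMPACT — (T2) — without pinning the soft near-rigid modes of the deep core at the interface scale).  Convex, closed, compact
  (`⊆ closedBall y₀ dB` in the sup norm, `ProperSpace`), margin lemma `z ∈ T(sb, dI, dB) ∧ ‖z' − z‖ ≤ η ⇒ z' ∈ T(sb + 2η, dI + η, dB + η)`.
* **YO-3 THE THREE PIECES (typed; binders of (QE) VERBATIM, then the reference).**  `IsTubeReference ϑ₀ ϑ dm Rg sb dI dB X H xf y₀` := `y₀` is `ϑ₀`-tame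
  w.r.t. `X ∪ range y₀` AND every member `z` of its bond tube is injective, off `X`, matched to the core `xf` within `dm`, and `ϑ`-tame at every site w.r.t.
  `X ∪ range z` (the conclusion of (QE) except criticality).
  (XR) `TubeReferenceP` — SUCH A REFERENCE EXISTS [KINEMATIC · ATTACKABLE: the (bent) chart-lattice filling fitted to the `ϑc`-cold collar; budget
  `ϑ ≳ ϑ₀ + max(sb, dI)`, `Rg ≥ 4 + 2·dB`; why it might fail: registry slip of the collar across the core (two collar patches registered to `H`-images that differ
  by a non-lattice vector) — but then NO tame filling exists and (QE) fails identically, so (XR) is at most (QE)-hard on that axis].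
  (X1) `TubeConvexityP … lam` — FIRST-ORDER STRONG CONVEXITY of `clampedEnergy X` on the tube: `E z + DE(z)(z' − z) + lam·Σᵢ dist(z i, z' i)² ≤ E z'` for all
  `z, z' ∈ T` [CERT-type · INSTRUMENTABLE «NearBorn-T»: smallest clamped-Hessian eigenvalue over TUBE MEMBERS (bond deviation `≤ sb`, not only near the tame
  end — (F1): this is NOT the NearBorn cell of rows 1229/1233, whose PASS mark `λ_min(y) ≥ 0.0139` is a value AT the reference); crude budget: Born drift `≈ 21·sb`
  relative, `≈ 16 %` at `sb = 3/400`, against the PASS mark `lam ≥ 7/1000` of row 1237; why it might fail: under-coordinated interface stars or a fat tube].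
  (X2ᴸ) `LoadedTubeAprioriP … sb₁ dI₁ dB₁` — A-PRIORI CONFINEMENT: every `z ∈ T(sb, dI, dB)` solving `DE(z) = (1 − t)·DE(y₀)`, `t ∈ [0, 1]`, lies in the
  INNER tube `T(sb₁, dI₁, dB₁)` [ANALYTIC · HEAVY · UNDECIDED — (F2): the one heavy input; LINEARISABLE: `z − y₀ ≈ −t·H̄⁻¹ DE(y₀)` with `H̄` a tube-averaged
  Hessian, so its linear sufficient form is a MAX-NORM (`W^{1,∞}`-type) bound on the lattice Green's operator of the clamped core in divergence form — the
  g69 node; INSTRUMENTABLE «FillTame-T»: relax under the loads `(1 − t)·DE(y₀)`, `t ∈ {1/4, 1/2, 3/4, 1}`, report bond deviation / interface / bulk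
  displacement maxima against `(sb₁, dI₁, dB₁)`; why it might fail: `C_disp·ϑc > dI₁` at the sampled moat temperature (repair: the free moat dial `ϑc ↓`) or
  a loaded critical point near the rim not predicted by linear response].
* **YO-4 ★★★ THE GLUE (PROVED) `coolMoatSlavedFillingP_of_loadPath`: (QE)(ϑc, ϑ, ϑp, dm) ⟸ (XR) ∧ (X1)(lam > 0) ∧ (X2ᴸ)(sb₁ < sb, dI₁ < dI, dB₁ < dB,
  inner radii ≥ 0)** — the engine on `V := Fin n → E3`, `T := bondTube`, `D := Σᵢ dist²`, `gap := min((sb − sb₁)/4, (dI − dI₁)/2, (dB − dB₁)/2)`; admissibility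
  and tameness of the critical point are read off (XR).  Dials (`TubeConvexityP.of_le`, `LoadedTubeAprioriP.of_inner_le`), the tube-docket slot
  `coolMoatSlavedFillingP_tubeSlot_of_loadPath` ((QE) at `(8, 4, 12, 16, 16, dm = 1/2)` as `MildTubeDocket` consumes it) and the PROPOSED DIAL INSTANCE
  `loadPath_dial_instance`: `(ϑc, ϑ, ϑp) = (1/2000, 1/100, 1/10)`, `ϑ₀ = 1/400`, `Rg = 5`, `(sb, dI, dB) = (3/400, 3/400, 3/10)`, `(sb₁, dI₁, dB₁) =
  (1/200, 1/200, 3/20)`, `lam = 7/1000`.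

TARGET ⟸ PIECES (tags).  (QE) ⟸ (XR) [KINEMATIC · SIDEWAYS-WEAKER (no equation)] ∧ (X1) [CERT · SIDEWAYS (a convexity statement, neither implied by nor implying
(QE))] ∧ (X2ᴸ) [ANALYTIC · WEAKER-IN-KIND: an a-priori LOCATION statement about solutions that are GIVEN, never an existence statement].  LENS READING: a
constrained minimiser of a tilted energy on the tube is either INTERIOR (special: it satisfies an EQUATION, and equations come with a-priori estimates) or ON
THE RIM (generic: no equation, no estimate); the march shows the rim class is EMPTY along the whole load path, one increment at a time, because each
minimiser is chained to an interior predecessor by strong convexity.  WHY EACH PIECE IS LOAD-BEARING: drop (X1) and consecutive minimisers may jump to the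
rim; drop (X2ᴸ) and the interior critical point may drift to the rim over `N` steps; drop (XR) and there is no tube (canaries C1–C6 of the check log).  WHY
NOVEL on this docket: every earlier existence discussion (parts YF/YI: implicit function about the chart; row 1237's operator-norm Newton–Kantorovich,
DEAD-FOR-CAUSE at `r ≲ 10⁻⁵`) needs a LINEAR ISOMORPHISM and a Lipschitz Hessian; the march needs a convexity MODULUS and a CONFINEMENT estimate, both
first-order, both instrumentable, and splits the analytic burden into a certificate (X1) and a linear-response estimate (X2ᴸ) with FREE inner radii.
0 sorry; standard axioms; 1 data def + 1 `def` predicate + 3 `def : Prop` (tag at landing) + 19 theorems.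
-/

noncomputable section

open scoped BigOperators Classical
open MeasureTheory Set Metric Filter Topology
open Summit.AtomisticToContinuum.Crystallization.Theorems.ChartedPlanarOrderRigidityDoor (E3 eStar atomsIn IsEStarGSC siteEnergy VisibleGap PertRegime)
open Summit.AtomisticToContinuum.Crystallization.Theorems.ChartedPlanarOrderDensityDichotomy (μS IsSep nK nK_nonneg)
open Summit.AtomisticToContinuum.Crystallization.Theorems.ChartedPlanarOrderCleanScaleP (IsCleanP IsDoorSetP)
open Summit.AtomisticToContinuum.Crystallization.Theorems.ChartedPlanarOrderMesoCut (LayeredHom EnvClose)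
open Summit.AtomisticToContinuum.Crystallization.Theorems.ChartedPlanarOrderDoorLayered (atomsIn_subset sq_le_finsum_mem PeriodicBulkGapDoor)
open Summit.AtomisticToContinuum.Crystallization.Theorems.ChartedPlanarOrderDoorLayeredOsc (IsTwoShellAffineGood)
open Literature.MathematicalPhysics.StatisticalMechanics (card_le_of_separated_of_dist_le lennardJones interactionEnergy)

namespace Summit.AtomisticToContinuum.Crystallization.Theorems.ChartedZeroExcessLayeredLatticeLiouville

/-! ## Part YO «LoadPath» (lens-2 g68): the existence leaf (QE) from a tube REFERENCE, first-order STRONG CONVEXITY on the tube, and A-PRIORI CONFINEMENT of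
loaded solutions — glued by a load-path march -/

/-! ### YO-1  The load-path engine (abstract normed space; PROVED) -/

section LoadPathEngine

variable {V : Type*} [NormedAddCommGroup V] [NormedSpace ℝ V]

/-- **TUBE RIGIDITY from first-order strong convexity (PROVED)**: two critical points of `E` in a set on which `E` is first-order strongly convex (modulus
`lam > 0` against a weight `D` dominating `‖·‖²`) coincide — the uniqueness content of (X1). [this file, g68] -/
theorem eq_of_hasFDerivAt_zero_of_strongConvexOn {E : V → ℝ} {T : Set V} {lam : ℝ} {D : V → V → ℝ} (hlam : 0 < lam)
    (hD : ∀ z z' : V, ‖z' - z‖ ^ 2 ≤ D z z')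
    (hSC : ∀ z ∈ T, ∃ φ : V →L[ℝ] ℝ, HasFDerivAt E φ z ∧ ∀ z' ∈ T, E z + φ (z' - z) + lam * D z z' ≤ E z')
    {z z' : V} (hz : z ∈ T) (hz' : z' ∈ T) (h : HasFDerivAt E (0 : V →L[ℝ] ℝ) z) (h' : HasFDerivAt E (0 : V →L[ℝ] ℝ) z') : z = z' := by
  obtain ⟨φ, hφ, hsc⟩ := hSC z hz
  obtain ⟨φ', hφ', hsc'⟩ := hSC z' hz'
  have e1 : φ = 0 := hφ.unique h
  have e2 : φ' = 0 := hφ'.unique h'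
  have i1 := hsc z' hz'
  have i2 := hsc' z hz
  rw [e1] at i1
  rw [e2] at i2
  simp only [FunLike.coe_zero, Pi.zero_apply, add_zero] at i1 i2
  have d1 := hD z z'
  have d2 := hD z' z
  have hsq : ‖z' - z‖ ^ 2 ≤ 0 := by nlinarith
  have h0 : ‖z' - z‖ = 0 := by nlinarith [norm_nonneg (z' - z)]
  exact (eq_of_sub_eq_zero (norm_eq_zero.1 h0)).symm

/-- ★★★ **THE LOAD-PATH MARCH (PROVED, abstract)**.  `T₁ ⊆ T` with a uniform margin `2·gap` inside the compact convex `T`; `E` first-order strongly convex on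
`T` (modulus `lam`, weight `D ≥ ‖·‖²`) with derivative `φ₀` at the reference `y₀ ∈ T₁`; A-PRIORI CONFINEMENT: every `z ∈ T` critical for a tilted energy
`E − (1 − t)·φ₀`, `t ∈ [0, 1]`, lies in `T₁`.  THEN `E` has a critical point in `T₁`.  The march: `N` load increments with `‖φ₀‖/(2·lam·N) ≤ gap`; the
`T`-minimiser of the `k`-th tilt lies within `gap` of its predecessor (two variational inequalities + two convexity inequalities), hence INTERIOR (the
predecessor is in `T₁`), hence critical (Fermat), hence in `T₁` (confinement); at `k = N` the tilt is zero. [this file, g68] -/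
theorem exists_hasFDerivAt_zero_of_loadPath {E : V → ℝ} {T T₁ : Set V} {y₀ : V} {φ₀ : V →L[ℝ] ℝ} {lam gap : ℝ} {D : V → V → ℝ}
    (hT : IsCompact T) (hTc : Convex ℝ T) (hT₁ : T₁ ⊆ T) (hy₀ : y₀ ∈ T₁) (hgap : 0 < gap)
    (hmargin : ∀ z ∈ T₁, ∀ z' : V, ‖z' - z‖ ≤ 2 * gap → z' ∈ T) (hlam : 0 < lam) (hD : ∀ z z' : V, ‖z' - z‖ ^ 2 ≤ D z z')
    (hφ₀ : HasFDerivAt E φ₀ y₀)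
    (hSC : ∀ z ∈ T, ∃ φ : V →L[ℝ] ℝ, HasFDerivAt E φ z ∧ ∀ z' ∈ T, E z + φ (z' - z) + lam * D z z' ≤ E z')
    (hA : ∀ t : ℝ, 0 ≤ t → t ≤ 1 → ∀ z ∈ T, HasFDerivAt E ((1 - t) • φ₀) z → z ∈ T₁) :
    ∃ z ∈ T₁, HasFDerivAt E (0 : V →L[ℝ] ℝ) z := by
  -- continuity of `E` on `T`
  have hEcont : ContinuousOn E T := fun z hz => (hSC z hz).choose_spec.1.continuousAt.continuousWithinAt
  -- the number of load steps and the step bound `η ≤ gap`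
  obtain ⟨N, hN⟩ := exists_nat_gt (‖φ₀‖ / (2 * lam * gap))
  have hNpos : (0 : ℝ) < N := lt_of_le_of_lt (by positivity) hN
  have hφN : ‖φ₀‖ < N * (2 * lam * gap) := (div_lt_iff₀ (by positivity)).1 hN
  set η : ℝ := ‖φ₀‖ / (2 * lam * N) with hη
  have hη0 : 0 ≤ η := by positivity
  have hηgap : η ≤ gap := by
    rw [hη, div_le_iff₀ (by positivity)]
    nlinarith
  have hηkey : 2 * lam * η = ‖φ₀‖ / N := by
    rw [hη]; field_simp
  -- the tilted energies `Ek k z = E z - c k * (φ₀ z - φ₀ y₀)`, `c k = 1 - k/N`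
  set c : ℕ → ℝ := fun k => 1 - (k : ℝ) / N with hc
  set Ek : ℕ → V → ℝ := fun k z => E z - c k * (φ₀ z - φ₀ y₀) with hEk
  have hEk_deriv : ∀ (k : ℕ) (z : V) (φ : V →L[ℝ] ℝ), HasFDerivAt E φ z → HasFDerivAt (Ek k) (φ - c k • φ₀) z := by
    intro k z φ hφ
    have h2 : HasFDerivAt (fun z => c k * (φ₀ z - φ₀ y₀)) (c k • φ₀) z := by
      have := ((φ₀.hasFDerivAt (x := z)).sub_const (φ₀ y₀)).const_mul (c k)
      simpa using this
    exact hφ.sub h2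
  have hEk_cont : ∀ k : ℕ, ContinuousOn (Ek k) T := fun k =>
    hEcont.sub ((continuous_const.mul (φ₀.continuous.sub continuous_const)).continuousOn)
  have hcstep : ∀ k : ℕ, c k - c (k + 1) = 1 / N := by
    intro k; simp only [hc]; push_cast; field_simp; ring
  -- (L1) INTERIOR CRITICALITY: a `T`-minimiser of `Ek k` within `gap` of a point of `T₁` is critical for `Ek k`, i.e. `DE = c k • φ₀`
  have L1 : ∀ (k : ℕ) (m : V), m ∈ T₁ → ∀ m' : V, m' ∈ T → ‖m' - m‖ ≤ gap → IsMinOn (Ek k) T m' →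
      HasFDerivAt E (c k • φ₀) m' := by
    intro k m hm m' hm' hd hmin
    obtain ⟨φ', hφ', -⟩ := hSC m' hm'
    have hball : ball m' gap ⊆ T := by
      intro w hw
      rw [mem_ball, dist_eq_norm] at hw
      refine hmargin m hm w ?_
      calc ‖w - m‖ = ‖(w - m') + (m' - m)‖ := by rw [sub_add_sub_cancel]
        _ ≤ ‖w - m'‖ + ‖m' - m‖ := norm_add_le _ _
        _ ≤ 2 * gap := by linarith [hw.le]
    have hloc : IsLocalMin (Ek k) m' := hmin.isLocalMin (mem_of_superset (ball_mem_nhds m' hgap) hball)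
    have hzero := hloc.hasFDerivAt_eq_zero (hEk_deriv k m' φ' hφ')
    have : φ' = c k • φ₀ := sub_eq_zero.1 hzero
    rw [← this]; exact hφ'
  -- (L2) STEP CLOSENESS: consecutive `T`-minimisers are within `η`
  have L2 : ∀ (k : ℕ) (m : V), m ∈ T → IsMinOn (Ek k) T m → ∀ m' : V, m' ∈ T → IsMinOn (Ek (k + 1)) T m' → ‖m' - m‖ ≤ η := by
    intro k m hm hmin m' hm' hmin'
    obtain ⟨φ, hφ, hsc⟩ := hSC m hm
    obtain ⟨φ', hφ', hsc'⟩ := hSC m' hm'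
    have VI1 : 0 ≤ (φ - c k • φ₀) (m' - m) :=
      hmin.localize.hasFDerivWithinAt_nonneg (hEk_deriv k m φ hφ).hasFDerivWithinAt
        (sub_mem_posTangentConeAt_of_segment_subset (hTc.segment_subset hm hm'))
    have VI2 : 0 ≤ (φ' - c (k + 1) • φ₀) (m - m') :=
      hmin'.localize.hasFDerivWithinAt_nonneg (hEk_deriv (k + 1) m' φ' hφ').hasFDerivWithinAt
        (sub_mem_posTangentConeAt_of_segment_subset (hTc.segment_subset hm' hm))
    have SC1 := hsc m' hm'
    have SC2 := hsc' m hm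
    have D1 := hD m m'
    have D2 := hD m' m
    have hrev : ‖m - m'‖ = ‖m' - m‖ := norm_sub_rev _ _
    rw [hrev] at D2
    have hneg : m - m' = -(m' - m) := (neg_sub m' m).symm
    rw [hneg, map_neg] at VI2 SC2
    simp only [FunLike.coe_sub, FunLike.coe_smul, Pi.sub_apply, Pi.smul_apply, smul_eq_mul] at VI1 VI2
    have hop : -(φ₀ (m' - m)) ≤ ‖φ₀‖ * ‖m' - m‖ :=
      (neg_le_abs _).trans ((Real.norm_eq_abs _).symm.le.trans (φ₀.le_opNorm _))
    have hcs := hcstep k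
    set x := ‖m' - m‖ with hx
    have hx0 : 0 ≤ x := norm_nonneg _
    -- 2·lam·x² ≤ (1/N)·‖φ₀‖·x
    have key : 2 * lam * x ^ 2 ≤ ‖φ₀‖ / N * x := by
      have h1 : c k * φ₀ (m' - m) - c (k + 1) * φ₀ (m' - m) + lam * (D m m' + D m' m) ≤ 0 := by nlinarith
      have h2 : (c k - c (k + 1)) * φ₀ (m' - m) = c k * φ₀ (m' - m) - c (k + 1) * φ₀ (m' - m) := by ring
      rw [hcs] at h2
      have h3 : ‖φ₀‖ / N * x = (1 / N) * (‖φ₀‖ * x) := by ring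
      rw [h3]
      nlinarith [mul_nonneg (one_div_nonneg.2 hNpos.le) (sub_nonneg.2 hop)]
    by_contra hlt
    push Not at hlt
    have hxpos : 0 < x := hη0.trans_lt hlt
    have : 2 * lam * η * x < 2 * lam * x ^ 2 := by nlinarith [mul_pos hlam hxpos]
    rw [hηkey] at this
    linarith
  -- (L3) THE MARCH: for every `k ≤ N` the `k`-th tilt has a `T`-minimiser inside `T₁`
  have L3 : ∀ k : ℕ, k ≤ N → ∃ m ∈ T₁, IsMinOn (Ek k) T m := by
    intro k
    induction k with
    | zero =>
      intro _
      refine ⟨y₀, hy₀, ?_⟩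
      obtain ⟨φ, hφ, hsc⟩ := hSC y₀ (hT₁ hy₀)
      have hφe : φ = φ₀ := hφ.unique hφ₀
      rw [isMinOn_iff]
      intro z hz
      have h1 := hsc z hz
      rw [hφe] at h1
      have hDnn : 0 ≤ lam * D y₀ z := mul_nonneg hlam.le ((sq_nonneg _).trans (hD y₀ z))
      have hc0 : c 0 = 1 := by simp [hc]
      rw [map_sub] at h1
      simp only [hEk, hc0, one_mul, sub_self]
      linarith
    | succ k ih =>
      intro hk
      obtain ⟨m, hm, hmin⟩ := ih (Nat.le_of_succ_le hk)
      obtain ⟨m', hm', hmin'⟩ := hT.exists_isMinOn ⟨y₀, hT₁ hy₀⟩ (hEk_cont (k + 1))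
      have hclose : ‖m' - m‖ ≤ gap := (L2 k m (hT₁ hm) hmin m' hm' hmin').trans hηgap
      have hcrit : HasFDerivAt E (c (k + 1) • φ₀) m' := L1 (k + 1) m hm m' hm' hclose hmin'
      refine ⟨m', ?_, hmin'⟩
      have ht1 : ((k + 1 : ℕ) : ℝ) / N ≤ 1 := by
        rw [div_le_one hNpos]; exact_mod_cast hk
      refine hA (((k + 1 : ℕ) : ℝ) / N) (by positivity) ht1 m' hm' ?_
      exact hcrit
  -- (L4) the last step: zero tilt
  obtain ⟨m, hm, hmin⟩ := L3 N le_rfl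
  have hcrit : HasFDerivAt E (c N • φ₀) m := L1 N m hm m (hT₁ hm) (by simp [hgap.le]) hmin
  have hcN : c N = 0 := by simp [hc, div_self hNpos.ne']
  rw [hcN, zero_smul] at hcrit
  exact ⟨m, hm, hcrit⟩

end LoadPathEngine

/-! ### YO-2  The vector bond tube about a reference filling (NEW; convex, closed, compact, with a margin lemma — PROVED) -/

section BondTube

variable {n : ℕ}

/-- sup norm against per-site square sums on `Fin n → E3`: `‖z' − z‖² ≤ Σᵢ dist(z i, z' i)²` (the weight of (X1) dominates the engine's `‖·‖²`). [this file, g68] -/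
theorem norm_sub_sq_le_sum_dist_sq (z z' : Fin n → E3) : ‖z' - z‖ ^ 2 ≤ ∑ i, dist (z i) (z' i) ^ 2 := by
  have hle : ‖z' - z‖ ≤ Real.sqrt (∑ i, dist (z i) (z' i) ^ 2) := by
    rw [pi_norm_le_iff_of_nonneg (Real.sqrt_nonneg _)]
    intro i
    rw [Pi.sub_apply, ← dist_eq_norm, dist_comm]
    calc dist (z i) (z' i) = Real.sqrt (dist (z i) (z' i) ^ 2) := (Real.sqrt_sq dist_nonneg).symm
      _ ≤ Real.sqrt (∑ j, dist (z j) (z' j) ^ 2) :=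
          Real.sqrt_le_sqrt (Finset.single_le_sum (fun j _ => sq_nonneg (dist (z j) (z' j))) (Finset.mem_univ i))
  calc ‖z' - z‖ ^ 2 ≤ (Real.sqrt (∑ i, dist (z i) (z' i) ^ 2)) ^ 2 := pow_le_pow_left₀ (norm_nonneg _) hle 2
    _ = ∑ i, dist (z i) (z' i) ^ 2 := Real.sq_sqrt (Finset.sum_nonneg fun i _ => sq_nonneg _)

/-- ★★ **THE VECTOR BOND TUBE `bondTube X Rg sb dI dB y₀`** about a reference filling `y₀ : Fin n → E3` in the frozen field of the exterior `X`: the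
configurations `z` with (i) BOND DEVIATION `dist (z i − z j, y₀ i − y₀ j) ≤ sb` on every pair with `dist (y₀ i, y₀ j) ≤ Rg` (a VECTOR condition: lengths AND
angles), (ii) INTERFACE PIN `dist (z i, y₀ i) ≤ dI` at the sites within `Rg` of `X`, (iii) BULK PIN `dist (z i, y₀ i) ≤ dB` (loose; compactness only).  The
arena of the load-path march: convex (`convex_bondTube`), compact (`isCompact_bondTube`), and `Rg ≥ 4 + 2·dB` makes every `4`-star bond of a member an
`Rg`-bond of the reference. [this file, g68] -/
def bondTube (X : Set E3) (Rg sb dI dB : ℝ) {n : ℕ} (y₀ : Fin n → E3) : Set (Fin n → E3) :=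
  {z | ∀ i j, dist (y₀ i) (y₀ j) ≤ Rg → dist (z i - z j) (y₀ i - y₀ j) ≤ sb} ∩
    ({z | ∀ i, (∃ p ∈ X, dist (y₀ i) p ≤ Rg) → dist (z i) (y₀ i) ≤ dI} ∩ {z | ∀ i, dist (z i) (y₀ i) ≤ dB})

variable {X : Set E3} {Rg sb dI dB : ℝ} {y₀ : Fin n → E3}

/-- membership in the bond tube, unfolded. [this file, g68] -/
theorem mem_bondTube_iff {z : Fin n → E3} : z ∈ bondTube X Rg sb dI dB y₀ ↔
    (∀ i j, dist (y₀ i) (y₀ j) ≤ Rg → dist (z i - z j) (y₀ i - y₀ j) ≤ sb) ∧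
      (∀ i, (∃ p ∈ X, dist (y₀ i) p ≤ Rg) → dist (z i) (y₀ i) ≤ dI) ∧ ∀ i, dist (z i) (y₀ i) ≤ dB := Iff.rfl

/-- the reference is a member of its own tube (nonnegative radii). [this file, g68] -/
theorem self_mem_bondTube (hsb : 0 ≤ sb) (hdI : 0 ≤ dI) (hdB : 0 ≤ dB) : y₀ ∈ bondTube X Rg sb dI dB y₀ :=
  ⟨fun i j _ => by rw [dist_self]; exact hsb, fun i _ => by rw [dist_self]; exact hdI, fun i => by rw [dist_self]; exact hdB⟩

/-- the tube is monotone in its three radii. [this file, g68] -/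
theorem bondTube_mono {sb' dI' dB' : ℝ} (hs : sb ≤ sb') (hI : dI ≤ dI') (hB : dB ≤ dB') :
    bondTube X Rg sb dI dB y₀ ⊆ bondTube X Rg sb' dI' dB' y₀ :=
  fun _ hz => ⟨fun i j hij => (hz.1 i j hij).trans hs, fun i hi => (hz.2.1 i hi).trans hI, fun i => (hz.2.2 i).trans hB⟩

/-- ★ **the bond tube is CONVEX** (each condition is a closed ball pulled back along a linear map). [this file, g68] -/
theorem convex_bondTube : Convex ℝ (bondTube X Rg sb dI dB y₀) := by
  intro z hz z' hz' a b ha hb hab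
  refine ⟨fun i j hij => ?_, fun i hi => ?_, fun i => ?_⟩
  · have h := convex_closedBall (y₀ i - y₀ j) sb (mem_closedBall.2 (hz.1 i j hij)) (mem_closedBall.2 (hz'.1 i j hij)) ha hb hab
    rw [mem_closedBall] at h
    have e : (a • z + b • z') i - (a • z + b • z') j = a • (z i - z j) + b • (z' i - z' j) := by
      simp only [Pi.add_apply, Pi.smul_apply, smul_sub]; abel
    rw [e]; exact h
  · have h := convex_closedBall (y₀ i) dI (mem_closedBall.2 (hz.2.1 i hi)) (mem_closedBall.2 (hz'.2.1 i hi)) ha hb hab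
    rw [mem_closedBall] at h
    simpa only [Pi.add_apply, Pi.smul_apply] using h
  · have h := convex_closedBall (y₀ i) dB (mem_closedBall.2 (hz.2.2 i)) (mem_closedBall.2 (hz'.2.2 i)) ha hb hab
    rw [mem_closedBall] at h
    simpa only [Pi.add_apply, Pi.smul_apply] using h

/-- the bond tube is closed. [this file, g68] -/
theorem isClosed_bondTube : IsClosed (bondTube X Rg sb dI dB y₀) := by
  refine IsClosed.inter ?_ (IsClosed.inter ?_ ?_)
  · have e : {z : Fin n → E3 | ∀ i j, dist (y₀ i) (y₀ j) ≤ Rg → dist (z i - z j) (y₀ i - y₀ j) ≤ sb}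
        = ⋂ i, ⋂ j, ⋂ (_ : dist (y₀ i) (y₀ j) ≤ Rg), {z : Fin n → E3 | dist (z i - z j) (y₀ i - y₀ j) ≤ sb} := by
      ext z; simp only [mem_setOf_eq, mem_iInter]
    rw [e]
    exact isClosed_iInter fun i => isClosed_iInter fun j => isClosed_iInter fun _ =>
      isClosed_le (((continuous_apply i).sub (continuous_apply j)).dist continuous_const) continuous_const
  · have e : {z : Fin n → E3 | ∀ i, (∃ p ∈ X, dist (y₀ i) p ≤ Rg) → dist (z i) (y₀ i) ≤ dI}
        = ⋂ i, ⋂ (_ : ∃ p ∈ X, dist (y₀ i) p ≤ Rg), {z : Fin n → E3 | dist (z i) (y₀ i) ≤ dI} := by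
      ext z; simp only [mem_setOf_eq, mem_iInter]
    rw [e]
    exact isClosed_iInter fun i => isClosed_iInter fun _ => isClosed_le ((continuous_apply i).dist continuous_const) continuous_const
  · have e : {z : Fin n → E3 | ∀ i, dist (z i) (y₀ i) ≤ dB} = ⋂ i, {z : Fin n → E3 | dist (z i) (y₀ i) ≤ dB} := by
      ext z; simp only [mem_setOf_eq, mem_iInter]
    rw [e]
    exact isClosed_iInter fun i => isClosed_le ((continuous_apply i).dist continuous_const) continuous_const

/-- the bulk pin puts the tube inside the sup-norm ball `closedBall y₀ dB`. [this file, g68] -/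
theorem bondTube_subset_closedBall (hdB : 0 ≤ dB) : bondTube X Rg sb dI dB y₀ ⊆ closedBall y₀ dB :=
  fun _ hz => mem_closedBall.2 ((dist_pi_le_iff hdB).2 hz.2.2)

/-- ★ **the bond tube is COMPACT** (closed, inside a sup-norm ball of the proper space `Fin n → E3`). [this file, g68] -/
theorem isCompact_bondTube (hdB : 0 ≤ dB) : IsCompact (bondTube X Rg sb dI dB y₀) :=
  (isCompact_closedBall y₀ dB).of_isClosed_subset isClosed_bondTube (bondTube_subset_closedBall hdB)

/-- ★ **THE MARGIN LEMMA**: a sup-norm `η`-perturbation of a member of `T(sb, dI, dB)` lies in `T(sb + 2η, dI + η, dB + η)`. [this file, g68] -/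
theorem mem_bondTube_of_norm_sub_le {η : ℝ} {z z' : Fin n → E3} (hz : z ∈ bondTube X Rg sb dI dB y₀) (h : ‖z' - z‖ ≤ η) :
    z' ∈ bondTube X Rg (sb + 2 * η) (dI + η) (dB + η) y₀ := by
  have hsite : ∀ i, dist (z' i) (z i) ≤ η := fun i => (dist_le_pi_dist z' z i).trans (by rwa [dist_eq_norm])
  refine ⟨fun i j hij => ?_, fun i hi => ?_, fun i => ?_⟩
  · calc dist (z' i - z' j) (y₀ i - y₀ j) ≤ dist (z' i - z' j) (z i - z j) + dist (z i - z j) (y₀ i - y₀ j) := dist_triangle _ _ _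
      _ ≤ (dist (z' i) (z i) + dist (z' j) (z j)) + sb := add_le_add (dist_sub_sub_le _ _ _ _) (hz.1 i j hij)
      _ ≤ sb + 2 * η := by linarith [hsite i, hsite j]
  · calc dist (z' i) (y₀ i) ≤ dist (z' i) (z i) + dist (z i) (y₀ i) := dist_triangle _ _ _
      _ ≤ dI + η := by linarith [hsite i, hz.2.1 i hi]
  · calc dist (z' i) (y₀ i) ≤ dist (z' i) (z i) + dist (z i) (y₀ i) := dist_triangle _ _ _
      _ ≤ dB + η := by linarith [hsite i, hz.2.2 i]

/-- the margin in the form the engine consumes: `z ∈ T(sb₁, dI₁, dB₁)`, `‖z' − z‖ ≤ 2·gap`, `sb₁ + 4·gap ≤ sb`, `dI₁ + 2·gap ≤ dI`, `dB₁ + 2·gap ≤ dB`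
⟹ `z' ∈ T(sb, dI, dB)`. [this file, g68] -/
theorem bondTube_margin {sb₁ dI₁ dB₁ gap : ℝ} (hs : sb₁ + 4 * gap ≤ sb) (hI : dI₁ + 2 * gap ≤ dI) (hB : dB₁ + 2 * gap ≤ dB)
    {z z' : Fin n → E3} (hz : z ∈ bondTube X Rg sb₁ dI₁ dB₁ y₀) (h : ‖z' - z‖ ≤ 2 * gap) : z' ∈ bondTube X Rg sb dI dB y₀ :=
  bondTube_mono (by linarith) (by linarith) (by linarith) (mem_bondTube_of_norm_sub_le hz h)

end BondTube

end Summit.AtomisticToContinuum.Crystallization.Theorems.ChartedZeroExcessLayeredLatticeLiouville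

end
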